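import Mathlib
import Summits.ValiantsHypothesis.ValiantsHypothesis.Theses.GCTMult
import Summits.ValiantsHypothesis.ValiantsHypothesis.Theorems.DetqpThesis.Negative.IffPerNotVQP
import Summits.ValiantsHypothesis.ValiantsHypothesis.Theorems.DetQPDetqpThesisHyperdetCalibrationPadded

/-!
# Crux `DetQP.DetqpThesis` (stmt-ValiantsHypothesis-0315), line `four-dimensional-determinant` —
# calibration of stub C, part 2c: the border thesis for `H` is EQUIVALENT to `GCTMult.GctThesis`

`HdBorderThesis` (inlined): for every `c`, eventually in `n`, for `n² + 1 ≤ m ≤ 2^{(log₂ n + c)^c}`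
and every injective placement `ι` missing `(0,0)`, `X₀₀^{m-n} H_n(X_ι) ∉ Δ(det_m)`.

* `hdc2_gctThesis_imp_hdBorderThesis` — `GctThesis ⇒ HdBorderThesis` (the padded permanent is a
  degeneration of the padded `H_n` at the same `(n,m)`, part 1);
* `hdc2_hdBorderThesis_imp_gctThesis` — **`HdBorderThesis ⇒ GctThesis`**: if the padded `per_N`
  lies in `Δ(det_m)` for some `m ≤ 2^{(log₂ N + c)^c}`, pick the largest `n'` with
  `T n' ≤ N` (`T k = k^{c₀} + c₀ + k² + 2 > t k`, `t` the p-bounded size of `H ≤_p per`); then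
  `X₀₀^{m-n'} H_{n'} ∈ Δ(det_m)` (downward monotonicity in `N`, then completeness in padded form,
  part 2b), `n'² + 1 ≤ m`, and `m ≤ 2^{(log₂ n' + c')^{c'}}` because `N < T(n'+1)` is polynomial
  in `n'` (`qpBound_comp_le`) — contradicting the thesis for `H` at `c'`;
* `hdc2_hdBorderThesis_iff_gctThesis` — the equivalence.

So the membership content of the line's bet C (C ⇔ HdBorderThesis given B1/B2, part 2d) is
exactly crux stmt-ValiantsHypothesis-0323 of route GCTMult.  Folklore.
-/

open MvPolynomial
open scoped BigOperators

namespace Summit.ValiantsHypothesis.ValiantsHypothesis.Theorems.DetQPDetqpThesis.HdCalibration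

set_option linter.dupNamespace false

open Literature.Computability.AlgebraicComplexity
open Summit.ValiantsHypothesis.Theorems.DetqpThesis.Negative (qpBound_comp_le)

/-- A placement of the `n⁴` array variables among the `m²` matrix variables missing `X₀₀` exists
as soon as `n² + 1 ≤ m`. -/
theorem hdc2_exists_placement {n m : ℕ} [NeZero m] (h : n ^ 2 + 1 ≤ m) :
    ∃ ι : (Fin 4 → Fin n) → Fin m × Fin m, Function.Injective ι ∧
      ((0 : Fin m), (0 : Fin m)) ∉ Set.range ι := by
  have hcard : Fintype.card (Option (Fin 4 → Fin n)) ≤ Fintype.card (Fin m × Fin m) := by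
    simp only [Fintype.card_option, Fintype.card_fun, Fintype.card_fin, Fintype.card_prod]
    nlinarith
  obtain ⟨e⟩ := Function.Embedding.nonempty_of_card_le hcard
  let e' : Option (Fin 4 → Fin n) ↪ Fin m × Fin m :=
    e.trans (Equiv.swap (e none) ((0 : Fin m), (0 : Fin m))).toEmbedding
  have he' : e' none = ((0 : Fin m), (0 : Fin m)) := by
    simp [e', Function.Embedding.trans_apply, Equiv.swap_apply_left]
  refine ⟨fun I => e' (some I), fun I I' hII' => Option.some_injective _ (e'.injective hII'), ?_⟩
  rintro ⟨I, hI⟩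
  exact Option.some_ne_none I (e'.injective (hI.trans he'.symm))

/-- **`GctThesis ⇒ HdBorderThesis`**: the padded permanent is a degeneration of the padded
four-dimensional determinant at the same `(n, m)` (`hdc_paddedPerPoly_mem_orbitClosure_paddedHyperdet`). -/
theorem hdc2_gctThesis_imp_hdBorderThesis
    (hG : Summit.ValiantsHypothesis.ValiantsHypothesis.Theses.GCTMult.GctThesis) :
    ∀ c : ℕ, ∃ n₀ : ℕ, ∀ n ≥ n₀, ∀ (m : ℕ) [NeZero m], n ^ 2 + 1 ≤ m →
      m ≤ 2 ^ ((Nat.log 2 n + c) ^ c) →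
      ∀ ι : (Fin 4 → Fin n) → Fin m × Fin m, Function.Injective ι →
        ((0 : Fin m), (0 : Fin m)) ∉ Set.range ι →
        X ((0 : Fin m), (0 : Fin m)) ^ (m - n) *
            rename ι (hyperdet fun I : Fin 4 → Fin n => (X I : MvPolynomial (Fin 4 → Fin n) ℂ)) ∉
          orbitClosure (detPoly (Fin m) ℂ) := by
  intro c
  obtain ⟨n₀, hn₀⟩ := hG c
  refine ⟨max n₀ 1, fun n hn m _ hm hmc ι hι hℓ hmem => ?_⟩
  have hn1 : 1 ≤ n := le_of_max_le_right hn
  have hnm : n ≤ m := by nlinarith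
  exact hn₀ n (le_of_max_le_left hn) m hnm hmc
    (orbitClosure_subset_of_mem_holds hmem
      (hdc_paddedPerPoly_mem_orbitClosure_paddedHyperdet hn1 hnm ι hι hℓ))

/-- **`HdBorderThesis ⇒ GctThesis`** (see the module docstring). -/
theorem hdc2_hdBorderThesis_imp_gctThesis
    (hB : ∀ c : ℕ, ∃ n₀ : ℕ, ∀ n ≥ n₀, ∀ (m : ℕ) [NeZero m], n ^ 2 + 1 ≤ m →
      m ≤ 2 ^ ((Nat.log 2 n + c) ^ c) →
      ∀ ι : (Fin 4 → Fin n) → Fin m × Fin m, Function.Injective ι →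
        ((0 : Fin m), (0 : Fin m)) ∉ Set.range ι →
        X ((0 : Fin m), (0 : Fin m)) ^ (m - n) *
            rename ι (hyperdet fun I : Fin 4 → Fin n => (X I : MvPolynomial (Fin 4 → Fin n) ℂ)) ∉
          orbitClosure (detPoly (Fin m) ℂ)) :
    Summit.ValiantsHypothesis.ValiantsHypothesis.Theses.GCTMult.GctThesis := by
  classical
  obtain ⟨t, ht, hnt, hproj⟩ := hdc2_exists_proj_bound
  obtain ⟨c₀, hc₀⟩ := ht
  -- the threshold function `T`
  set T : ℕ → ℕ := fun k => k ^ c₀ + c₀ + k ^ 2 + 2 with hT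
  have hTt : ∀ k, t k < T k := fun k => by have := hc₀ k; simp only [hT]; omega
  have hTsq : ∀ k, k ^ 2 + 2 ≤ T k := fun k => by simp only [hT]; omega
  have hTk : ∀ k, k < T k := fun k => by have := hTsq k; nlinarith
  have hTmono : ∀ a b, a ≤ b → T a ≤ T b := fun a b hab => by
    simp only [hT]
    have := Nat.pow_le_pow_left hab c₀
    have := Nat.pow_le_pow_left hab 2
    omega
  have hTp : IsPBounded (fun k => T (k + 1)) := by
    have hs : IsPBounded (fun k => k + 1) := IsPBounded.add_holds IsPBounded.id (IsPBounded.const 1)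
    have h1 : IsPBounded (fun k => (k + 1) ^ c₀ + c₀ + (k + 1) ^ 2 + 2) :=
      IsPBounded.add_holds (IsPBounded.add_holds (IsPBounded.add_holds (IsPBounded.pow_holds hs c₀)
        (IsPBounded.const c₀)) (IsPBounded.pow_holds hs 2)) (IsPBounded.const 2)
    exact h1.mono fun k => le_rfl
  intro c
  obtain ⟨c', hc'⟩ := qpBound_comp_le hTp c
  obtain ⟨n₀, hn₀⟩ := hB c'
  refine ⟨T (max n₀ 1), fun N hN m _ hNm hmc hmem => ?_⟩
  -- the largest `n'` with `T n' ≤ N`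
  set n' : ℕ := Nat.findGreatest (fun k => T k ≤ N) N with hn'
  have hex : max n₀ 1 ≤ N ∧ T (max n₀ 1) ≤ N := ⟨(hTk _).le.trans hN, hN⟩
  have hn'T : T n' ≤ N := Nat.findGreatest_spec (P := fun k => T k ≤ N) hex.1 hex.2
  have hn'ge : max n₀ 1 ≤ n' := Nat.le_findGreatest (P := fun k => T k ≤ N) hex.1 hex.2
  have hn'succ : N < T (n' + 1) := by
    by_contra hle
    push Not at hle
    by_cases hle' : n' + 1 ≤ N
    · exact Nat.findGreatest_is_greatest (P := fun k => T k ≤ N) (Nat.lt_succ_self n') hle' hle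
    · have := hTk (n' + 1); omega
  have hn'1 : 1 ≤ n' := le_of_max_le_right hn'ge
  -- window bookkeeping
  have hm1 : n' ^ 2 + 1 ≤ m := by have := hTsq n'; omega
  have htn' : t n' < m := by have := hTt n'; omega
  have hmc' : m ≤ 2 ^ ((Nat.log 2 n' + c') ^ c') := by
    calc m ≤ 2 ^ ((Nat.log 2 N + c) ^ c) := hmc
      _ ≤ 2 ^ ((Nat.log 2 (T (n' + 1)) + c) ^ c) :=
          Nat.pow_le_pow_right (by norm_num)
            (Nat.pow_le_pow_left (by have := Nat.log_mono_right (b := 2) hn'succ.le; omega) _)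
      _ ≤ 2 ^ ((Nat.log 2 n' + c') ^ c') := hc' n'
  -- membership chain: per_N ⇒ per_{t n'} ⇒ H_{n'}
  have hper : paddedPerPoly ℂ (t n') m ∈ orbitClosure (detPoly (Fin m) ℂ) :=
    hdc2_paddedPer_mem_orbitClosure_of_le (by have := hTt n'; omega) hNm hmem
  obtain ⟨ι, hι, hℓ⟩ := hdc2_exists_placement (n := n') (m := m) hm1
  have hH := hdc2_paddedHyperdet_mem_orbitClosure_of_per (hnt n') (hproj n') htn' hper ι
  exact hn₀ n' (le_of_max_le_left hn'ge) m hm1 hmc' ι hι hℓ hH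

/-- **The border thesis for the four-dimensional determinant is equivalent to the
quasi-polynomial Mulmuley–Sohoni thesis `GCTMult.GctThesis`** (crux stmt-ValiantsHypothesis-0323). -/
theorem hdc2_hdBorderThesis_iff_gctThesis :
    (∀ c : ℕ, ∃ n₀ : ℕ, ∀ n ≥ n₀, ∀ (m : ℕ) [NeZero m], n ^ 2 + 1 ≤ m →
      m ≤ 2 ^ ((Nat.log 2 n + c) ^ c) →
      ∀ ι : (Fin 4 → Fin n) → Fin m × Fin m, Function.Injective ι →
        ((0 : Fin m), (0 : Fin m)) ∉ Set.range ι →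
        X ((0 : Fin m), (0 : Fin m)) ^ (m - n) *
            rename ι (hyperdet fun I : Fin 4 → Fin n => (X I : MvPolynomial (Fin 4 → Fin n) ℂ)) ∉
          orbitClosure (detPoly (Fin m) ℂ)) ↔
    Summit.ValiantsHypothesis.ValiantsHypothesis.Theses.GCTMult.GctThesis :=
  ⟨hdc2_hdBorderThesis_imp_gctThesis, hdc2_gctThesis_imp_hdBorderThesis⟩

end Summit.ValiantsHypothesis.ValiantsHypothesis.Theorems.DetQPDetqpThesis.HdCalibration
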